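import Literature.NumberTheory.EllipticCurves.WeilPairingProofs
import Literature.NumberTheory.EllipticCurves.PrimaryTorsionFrobeniusUnramifiedProofs
import Literature.NumberTheory.GaloisRepresentations.LocalWeilDatumUnramified
import HarnessLib

/-!
# `ker(Frob − q | E[m])` is the Weil-pairing annihilator of `(Frob − 1)E[m]` at a place `w ∤ m`
# — PROVED

Topic `NumberTheory/EllipticCurves`; namespace `WeierstrassCurve`. THEOREMS ONLY (no definition, no
named fact, no instance, no `sorry`; D-0026). Cell `bsd-stepL` (typer lane `defn-ty1`, g9): the
Weil-pairing step of module L4a of the discharge plan for the named LOCAL fact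
`JetchevSkinnerWan2017.sigmaLocal_charIdeal_eulerFactor_mem_of_noTamagawaDefect`
(`HOME/defn-ty1/g9/NOTE-sigmaLocal-discharge-plan-defn-ty1-g9.md`): the comparison of the two finite
groups `ker(Frob_w − q_w | E[pⁿ])` (which receives `H¹(K_w, E[p^∞])`, files
`PrimaryTorsionLocalH1InertiaRestrictionProofs`, `PrimaryTorsionLocalCocycleInertiaValuesProofs`) and
`ker(Frob_w − 1 | E[pⁿ]) = E(K_w)[pⁿ]` (bounded by `#Ẽ_w(k_w)`,
`PrimaryTorsionLocalInvariantsGoodReductionProofs`) — local Tate duality for `E[pⁿ]` made explicit by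
the Weil pairing: `E[m](−1)^{Frob=1}` is Cartier dual to the coinvariants `E[m]_{Frob}`.

## What is proved

For an elliptic curve `W` over a number field `K`, a finite place `w`, an arithmetic Frobenius lift
`φ ∈ Γ_{K_w}` with `g = absGaloisRestrict K K_w φ ∈ Γ_K` (the tree's `localMap K (Sum.inl w) φ`),
`q = q_w`, an integer `m ≥ 2` prime to `w`, and a Weil pairing `e` on `E[m]` (the tree's PROVED
`exists_weilPairing_holds`: bilinear, alternating, non-degenerate, Galois-equivariant):
* `absGaloisRestrict_smul_eq_pow_of_pow_eq_one` — **`g ζ = ζ^q` for every `m`-th root of unity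
  `ζ ∈ K̄`** (the tree's local statement `LocalWeilDatum.smul_eq_pow_of_isFrobPow`, moved to `K̄` along
  the chosen embedding, `absGaloisRestrict_apply_smul`);
* `weilPairing_smul_left_eq` — the ADJUNCTION `e(g S, T) = e(S, q · g⁻¹ T)`;
* **`smul_eq_natCast_smul_iff_forall_weilPairing_eq_one`** — for `T ∈ E[m]`:
  `g T = q T ↔ ∀ S ∈ E[m], e(g S − S, T) = 1`, i.e. `ker(g − q | E[m])` is the right annihilator of
  `(g − 1) E[m]` under `e`.

HONEST FRAMING: the COUNT `#ker(g − q | E[m]) ≤ #(E[m]/(g − 1)E[m]) = #ker(g − 1 | E[m])` (characters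
of a finite abelian group with values in `K̄ˣ` are at most its order — Dedekind independence) is NOT in
this file; nothing about `H¹`; the named fact is NOT discharged here.

References: [SilvermanAEC2009] III.8.1 (Weil pairing), C.21 Remark 21.3; [SerreLocalFields1979] Ch. IV
§4 Prop. 16 (Frobenius on roots of unity of order prime to `p`); [MilneADT2006] I Cor. 2.3 (local
duality for finite modules); [GreenbergLNM1716] §2. Tree: `WeilPairingProofs` (`exists_weilPairing_holds`),
`LocalWeilDatumUnramified` (`LocalWeilDatum.smul_eq_pow_of_isFrobPow`), `AbsGaloisGroup`
(`absGaloisRestrict_apply_smul`).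
-/

noncomputable section

open scoped Classical
open Field ValuativeRel NumberField IsDedekindDomain IsDedekindDomain.HeightOneSpectrum
open Literature.NumberTheory.EllipticCurves Literature.NumberTheory.GaloisRepresentations
  Literature.NumberTheory.GaloisRepresentations.IsNonarchimedeanLocalField

namespace WeierstrassCurve

variable {K : Type} [Field K] [NumberField K] (W : WeierstrassCurve K) [W.IsElliptic]
  {w : HeightOneSpectrum (𝓞 K)}

/-! ## §1 Frobenius on roots of unity of `K̄` of order prime to `w` -/

omit [W.IsElliptic] in
/-- **`g ζ = ζ^{q_w}` for `ζ ∈ μ_m(K̄)`, `w ∤ m`**, where `g = absGaloisRestrict K K_w φ` is the chosen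
restriction of an arithmetic Frobenius lift `φ ∈ Γ_{K_w}`: transport of the tree's local statement
(`LocalWeilDatum.smul_eq_pow_of_isFrobPow`, Serre IV §4 Prop. 16) along the chosen embedding
`ι : K̄ → K̄_w` (`absGaloisRestrict_apply_smul`: `ι (g x) = φ (ι x)`).
[cite: SerreLocalFields1979, Ch. IV §4 Prop. 16] -/
theorem absGaloisRestrict_smul_eq_pow_of_pow_eq_one {m : ℕ}
    (hm : ¬ ringChar 𝓀[w.adicCompletion K] ∣ m) (hm0 : m ≠ 0)
    {φ : absoluteGaloisGroup (w.adicCompletion K)} (hφ : IsFrobPow φ 1)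
    {ζ : AlgebraicClosure K} (hζ : ζ ^ m = 1) :
    absGaloisRestrict K (w.adicCompletion K) φ • ζ = ζ ^ residueFieldCard (w.adicCompletion K) := by
  have hφ' : IsFrobPow φ ((1 : ℕ) : ℤ) := by simpa using hφ
  apply (absClosureEmbedding K (w.adicCompletion K)).injective
  have hιζ : (absClosureEmbedding K (w.adicCompletion K) ζ) ^ m = 1 := by rw [← map_pow, hζ, map_one]
  change absClosureEmbedding K (w.adicCompletion K) (absGaloisRestrict K (w.adicCompletion K) φ • ζ) =
    absClosureEmbedding K (w.adicCompletion K) (ζ ^ residueFieldCard (w.adicCompletion K))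
  rw [absGaloisRestrict_apply_smul, map_pow,
    LocalWeilDatum.smul_eq_pow_of_isFrobPow (w.adicCompletion K) hm hm0 hφ' hιζ, pow_one]

/-! ## §2 The Weil pairing and Frobenius: adjunction and the annihilator of `(g − 1)E[m]` -/

section Pairing

variable {m : ℕ} (e : geomTorsion W m → geomTorsion W m → AlgebraicClosure K)
  (hμ : ∀ S T, e S T ^ m = 1)
  (haddl : ∀ S₁ S₂ T, e (S₁ + S₂) T = e S₁ T * e S₂ T)
  (haddr : ∀ S T₁ T₂, e S (T₁ + T₂) = e S T₁ * e S T₂)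
  (hnd : ∀ T, (∀ S, e S T = 1) → T = 0)
  (hgal : ∀ (σ : absoluteGaloisGroup K) (S T : geomTorsion W m), σ • e S T = e (σ • S) (σ • T))

include haddr in
omit [NumberField K] [W.IsElliptic] in
/-- `e(S, 0) = 1`. [cite: SilvermanAEC2009, Prop. III.8.1(a)] -/
theorem weilPairing_zero_right (S : geomTorsion W m) (h1 : e S 0 ≠ 0) : e S 0 = 1 := by
  have h := haddr S 0 0
  rw [add_zero] at h
  exact (mul_eq_left₀ h1).1 h.symm

include haddr in
omit [NumberField K] [W.IsElliptic] in
/-- `e(S, n • T) = e(S, T)^n`. [cite: SilvermanAEC2009, Prop. III.8.1(a)] -/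
theorem weilPairing_nsmul_right (S : geomTorsion W m) (h1 : e S 0 = 1) (T : geomTorsion W m) (n : ℕ) :
    e S (n • T) = e S T ^ n := by
  induction n with
  | zero => rw [zero_smul, pow_zero, h1]
  | succ n ih => rw [add_smul, one_smul, haddr, ih, pow_succ]

include hμ haddr in
omit [NumberField K] [W.IsElliptic] in
/-- Values of the pairing are non-zero (`m ≥ 1`) and `e(S, 0) = 1`. [cite: SilvermanAEC2009, Prop. III.8.1(a)] -/
theorem weilPairing_zero_right' (hm0 : m ≠ 0) (S : geomTorsion W m) : e S 0 = 1 := by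
  refine weilPairing_zero_right W e haddr S fun h0 ↦ ?_
  have h := hμ S 0
  rw [h0, zero_pow hm0] at h
  exact zero_ne_one h

include hμ haddr hgal in
omit [W.IsElliptic] in
/-- **Adjunction `e(g S, T) = e(S, q · g⁻¹ T)`** for `g` the restriction of an arithmetic Frobenius
lift at `w ∤ m`: `e(gS, T) = g · e(S, g⁻¹T) = e(S, g⁻¹T)^q` (`g` acts on `μ_m` by the `q`-th power).
[cite: SilvermanAEC2009, Prop. III.8.1(d)] [cite: SerreLocalFields1979, Ch. IV §4 Prop. 16] -/
theorem weilPairing_smul_left_eq (hm : ¬ ringChar 𝓀[w.adicCompletion K] ∣ m) (hm0 : m ≠ 0)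
    {φ : absoluteGaloisGroup (w.adicCompletion K)} (hφ : IsFrobPow φ 1) (S T : geomTorsion W m) :
    e (absGaloisRestrict K (w.adicCompletion K) φ • S) T =
      e S (residueFieldCard (w.adicCompletion K) • (absGaloisRestrict K (w.adicCompletion K) φ)⁻¹ • T) := by
  have h1 : e (absGaloisRestrict K (w.adicCompletion K) φ • S) T =
      absGaloisRestrict K (w.adicCompletion K) φ •
        e S ((absGaloisRestrict K (w.adicCompletion K) φ)⁻¹ • T) := by
    rw [hgal _ S (_ • T), smul_inv_smul]
  rw [h1, absGaloisRestrict_smul_eq_pow_of_pow_eq_one hm hm0 hφ (hμ S (_ • T)),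
    W.weilPairing_nsmul_right e haddr S (W.weilPairing_zero_right' e hμ haddr hm0 S)]

include hμ haddl haddr hnd hgal in
omit [W.IsElliptic] in
/-- **`ker(g − q | E[m])` is the right annihilator of `(g − 1)E[m]`**: for `T ∈ E[m]`,
`g T = q T ↔ ∀ S, e(g S − S, T) = 1` — from the adjunction `e(gS, T) = e(S, q g⁻¹ T)` and the
non-degeneracy of `e`; this is the explicit form of the local duality between `E[m](−1)^{Frob = 1}` and
the Frobenius coinvariants of `E[m]`.
[cite: MilneADT2006, I Cor. 2.3] [cite: SilvermanAEC2009, Prop. III.8.1] [cite: GreenbergLNM1716, §2 (p. 71)] -/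
theorem smul_eq_natCast_smul_iff_forall_weilPairing_eq_one
    (hm : ¬ ringChar 𝓀[w.adicCompletion K] ∣ m) (hm0 : m ≠ 0)
    {φ : absoluteGaloisGroup (w.adicCompletion K)} (hφ : IsFrobPow φ 1) (T : geomTorsion W m) :
    absGaloisRestrict K (w.adicCompletion K) φ • T = residueFieldCard (w.adicCompletion K) • T ↔
      ∀ S : geomTorsion W m,
        e (absGaloisRestrict K (w.adicCompletion K) φ • S - S) T = 1 := by
  set g := absGaloisRestrict K (w.adicCompletion K) φ with hg
  set q := residueFieldCard (w.adicCompletion K) with hq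
  have hne : ∀ S T, e S T ≠ 0 := fun S T h0 ↦ by
    have h := hμ S T
    rw [h0, zero_pow hm0] at h
    exact zero_ne_one h
  -- `e(gS − S, T) · e(S, T) = e(gS, T) = e(S, q g⁻¹ T)`
  have key : ∀ S, e (g • S - S) T * e S T = e S (q • g⁻¹ • T) := fun S ↦ by
    rw [← haddl, sub_add_cancel, hg, W.weilPairing_smul_left_eq e hμ haddr hgal hm hm0 hφ S T]
  constructor
  · intro hT S
    have hT' : q • g⁻¹ • T = T := by
      rw [smul_comm q g⁻¹ T, ← hT, inv_smul_smul]
    have h := key S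
    rw [hT'] at h
    exact (mul_eq_right₀ (hne S T)).1 h
  · intro h
    -- `e(S, q g⁻¹ T − T) = 1` for all `S`, hence `q g⁻¹ T = T`
    have h2 : ∀ S, e S (q • g⁻¹ • T - T) = 1 := fun S ↦ by
      have hk := key S
      rw [h S, one_mul] at hk
      have h3 : e S (q • g⁻¹ • T - T) * e S T = e S T := by
        rw [← haddr, sub_add_cancel, ← hk]
      exact (mul_eq_right₀ (hne S T)).1 h3
    have h4 : q • g⁻¹ • T - T = 0 := hnd _ h2
    rw [sub_eq_zero] at h4
    calc g • T = g • (q • g⁻¹ • T) := by rw [h4]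
      _ = q • T := by rw [smul_comm q g⁻¹ T, smul_inv_smul]

end Pairing

/-- **Packaged with the tree's Weil pairing** (`exists_weilPairing_holds`): at a finite place `w ∤ m`,
`m ≥ 2`, for the restriction `g` of any arithmetic Frobenius lift there is a pairing `e` on `E[m]` with
values in `μ_m(K̄)`, bilinear, alternating, non-degenerate and Galois-equivariant, for which
`ker(g − q_w | E[m]) = {T | ∀ S, e(gS − S, T) = 1}`.
[cite: SilvermanAEC2009, Prop. III.8.1] [cite: MilneADT2006, I Cor. 2.3] -/
theorem exists_weilPairing_smul_eq_natCast_smul_iff {m : ℕ} (h2m : 2 ≤ m)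
    (hm : ¬ ringChar 𝓀[w.adicCompletion K] ∣ m)
    {φ : absoluteGaloisGroup (w.adicCompletion K)} (hφ : IsFrobPow φ 1) :
    ∃ e : geomTorsion W m → geomTorsion W m → AlgebraicClosure K,
      (∀ S T, e S T ^ m = 1) ∧ (∀ S₁ S₂ T, e (S₁ + S₂) T = e S₁ T * e S₂ T) ∧
      (∀ S T₁ T₂, e S (T₁ + T₂) = e S T₁ * e S T₂) ∧ (∀ T, e T T = 1) ∧
      (∀ T, (∀ S, e S T = 1) → T = 0) ∧
      (∀ (σ : absoluteGaloisGroup K) (S T : geomTorsion W m), σ • e S T = e (σ • S) (σ • T)) ∧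
      ∀ T : geomTorsion W m,
        (absGaloisRestrict K (w.adicCompletion K) φ • T = residueFieldCard (w.adicCompletion K) • T ↔
          ∀ S : geomTorsion W m, e (absGaloisRestrict K (w.adicCompletion K) φ • S - S) T = 1) := by
  have hm0 : m ≠ 0 := by omega
  have hmK : (m : K) ≠ 0 := Nat.cast_ne_zero.2 hm0
  obtain ⟨e, hμ, haddl, haddr, halt, hnd, hgal⟩ := exists_weilPairing_holds W m h2m hmK
  exact ⟨e, hμ, haddl, haddr, halt, hnd, hgal, fun T ↦
    W.smul_eq_natCast_smul_iff_forall_weilPairing_eq_one e hμ haddl haddr hnd hgal hm hm0 hφ T⟩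

end WeierstrassCurve

end
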